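import Literature.NumberTheory.Automorphic.UnitaryGroupBorelConstantTermIndependence
import Literature.NumberTheory.Automorphic.UnitaryGroupHeisenbergFundamentalDomain
import Literature.NumberTheory.Automorphic.LatticeUnimodular
import HarnessLib

/-!
# `N(𝔸_F)` of `U(3)` is unimodular; every fundamental domain of `N(F)` has finite positive measure;
# the Borel constant term is left `N(𝔸_F)`-invariant
(Rogawski, *Automorphic Representations of Unitary Groups in Three Variables* (1990), §1.10, §2.1;
Deitmar–Echterhoff, *Principles of Harmonic Analysis* (2014), Thm. 9.1.6)

Topic `NumberTheory/Automorphic`; namespace `Literature.NumberTheory.Automorphic` (§1, generic) and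
`Literature.NumberTheory.Automorphic.UnitaryGroup` (§§2–3). THEOREMS ONLY over Mathlib and accepted
tree modules: no definition, no named fact, no `sorry`, no instance, no notation.

* §1 (generic). For a right-invariant (and left-invariant, s-finite) measure `μ` on a second
  countable group, a countable subgroup `Γ` acting by LEFT translation with a fundamental domain `𝓕`,
  and a `Γ`-invariant `f`: `∫_𝓕 f(x g) dμ(x) = ∫_𝓕 f dμ` and `μ(𝓕 g) = μ(𝓕)` — right translation by
  `g` carries `𝓕` to the fundamental domain `𝓕 g` (★ `isFundamentalDomain_image_mul_right` of
  `LatticeUnimodular`) over which a `Γ`-invariant function has the same integral.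
* §2 (`U(J_N)`, every `N`). If the Haar measure `ν` of `N(𝔸_F)` is right invariant, the Borel constant
  term of a left `N(F)`-invariant `φ` is left `N(𝔸_F)`-invariant: `φ_B(n g) = φ_B(g)`, `n ∈ N(𝔸_F)`
  (`borelConstantTerm_unipotent_mul_of_isMulRightInvariant`) — with §2 of
  `UnitaryGroupBorelConstantTermInvariance`, `φ_B` lives on `N(𝔸_F)B(F)\G(𝔸_F)` [Rogawski1990, §2.1;
  MoeglinWaldspurger1995, I.2.6].
* §3 (`U(3)`, `c² = 1`). Every fundamental domain `𝓕` of `N(F)` in the Heisenberg group `N(𝔸_F)` has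
  `0 < ν(𝓕) < ∞` for every Haar measure `ν` (comparison with the relatively compact domain
  ★ `heisFundamentalDomain` of `UnitaryGroupHeisenbergFundamentalDomain`); hence **`N(𝔸_F)` is
  unimodular** — every Haar measure on it is right invariant (★ `isMulRightInvariant_of_isFundamentalDomain`,
  `LatticeUnimodular`: a group with a lattice is unimodular, Deitmar–Echterhoff Thm. 9.1.6) — and
  `φ_B(n g) = φ_B(g)` on `U(3)` unconditionally; moreover the normalising factor `ν(𝓕)⁻¹` of the
  T1-qs letters is never the junk value, and for continuous left `N(F)`-invariant `φ` the data-free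
  ★ `BorelCuspCondition` is equivalent to ★ `IsBorelCuspidal ν₀ 𝓕₀` for any single Haar measure and
  fundamental domain (`borelCuspCondition_iff_isBorelCuspidal_three`).

## References

* J. D. Rogawski, *Automorphic Representations of Unitary Groups in Three Variables*, Annals of
  Mathematics Studies 123 (1990), §1.10 (`N`, `N(F)\𝐍` compact), §2.1 (p. 11: `φ_P`) [Rogawski1990].
* A. Deitmar, S. Echterhoff, *Principles of Harmonic Analysis*, 2nd ed. (2014), Thm. 9.1.6 («if `G`
  admits a lattice, then `G` is unimodular») [DeitmarEchterhoff2014].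
* C. Mœglin, J.-L. Waldspurger, *Spectral decomposition and Eisenstein series* (1995), I.2.6
  [MoeglinWaldspurger1995].
-/

noncomputable section

open MeasureTheory Measure NumberField IsDedekindDomain Topology Set
open scoped NNReal ENNReal Pointwise

namespace Literature.NumberTheory.Automorphic

/-! ## §1 Right translates: `∫_𝓕 f(x g) dμ = ∫_𝓕 f dμ` for `Γ`-invariant `f` and right-invariant `μ` -/

section Generic

variable {G : Type*} [Group G] [TopologicalSpace G] [IsTopologicalGroup G] [SecondCountableTopology G]
  [MeasurableSpace G] [BorelSpace G] (Γ : Subgroup G) (μ : Measure G) [SFinite μ]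
  [μ.IsMulLeftInvariant] [μ.IsMulRightInvariant]

/-- **Right translation invariance of integrals over a fundamental domain**: for a left- and
right-invariant s-finite measure `μ`, a countable subgroup `Γ` acting by left translation with
fundamental domain `𝓕`, and a `Γ`-invariant `f`, `∫_𝓕 f(x g) dμ(x) = ∫_𝓕 f dμ` — the substitution
`x ↦ x g` carries `𝓕` onto the fundamental domain `𝓕 g` (★ `isFundamentalDomain_image_mul_right`),
preserves `μ`, and `Γ`-invariant functions have the same integral over all fundamental domains
(Mathlib `IsFundamentalDomain.setIntegral_eq`). This is the right-`G`-invariance of `∫_{Γ\G}`, for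
the unimodular groups carrying lattices (Deitmar–Echterhoff (2014), Thm. 9.1.6 and §9.2).
[cite: DeitmarEchterhoff2014, Thm. 9.1.6] -/
theorem setIntegral_mul_right_eq_of_isFundamentalDomain [Countable Γ] {𝓕 : Set G}
    (h𝓕 : IsFundamentalDomain Γ 𝓕 μ) {V : Type*} [NormedAddCommGroup V] [NormedSpace ℝ V]
    {f : G → V} (hf : ∀ γ ∈ Γ, ∀ x : G, f (γ * x) = f x) (g : G) :
    ∫ x in 𝓕, f (x * g) ∂μ = ∫ x in 𝓕, f x ∂μ := by
  haveI : MeasurableConstSMul Γ G := ⟨fun γ => (continuous_const.mul continuous_id).measurable⟩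
  haveI : SMulInvariantMeasure Γ G μ := ⟨fun γ s _hs => by
    rw [show (fun x : G => γ • x) ⁻¹' s = (fun x : G => (γ : G) * x) ⁻¹' s from rfl,
      measure_preimage_mul]⟩
  have hf' : ∀ (γ : Γ) (x : G), f (γ • x) = f x := fun γ x => hf γ γ.2 x
  have h𝓕g := isFundamentalDomain_image_mul_right Γ μ h𝓕 g
  let e : G ≃ᵐ G := MeasurableEquiv.mulRight g
  have he : (e : G → G) = fun x => x * g := rfl
  have hpre : e ⁻¹' ((· * g) '' 𝓕) = 𝓕 := by
    rw [← he]; exact e.toEquiv.preimage_image 𝓕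
  calc ∫ x in 𝓕, f (x * g) ∂μ = ∫ x in e ⁻¹' ((· * g) '' 𝓕), f (e x) ∂μ := by rw [hpre, he]
    _ = ∫ y in (· * g) '' 𝓕, f y ∂(μ.map e) := (setIntegral_map_equiv e f _).symm
    _ = ∫ y in (· * g) '' 𝓕, f y ∂μ := by rw [he, map_mul_right_eq_self μ g]
    _ = ∫ x in 𝓕, f x ∂μ := h𝓕g.setIntegral_eq h𝓕 hf'

end Generic

namespace UnitaryGroup

variable {F E : Type} [Field F] [NumberField F] [Field E] [NumberField E] [Algebra F E]
  {c : E ≃ₐ[F] E} {N : ℕ}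

omit [NumberField F] [Algebra F E] in
/-- `𝔸_E` is Hausdorff (local copy of the standard three-line argument). [folklore] -/
private theorem t2Space_adeleRing_E''' : T2Space (AdeleRing (𝓞 E) E) := by
  haveI : T2Space (FiniteAdeleRing (𝓞 E) E) := inferInstanceAs <| T2Space
    (RestrictedProduct (fun w : HeightOneSpectrum (𝓞 E) => w.adicCompletion E)
      (fun w => (w.adicCompletionIntegers E : Set (w.adicCompletion E))) Filter.cofinite)
  haveI : T2Space (InfiniteAdeleRing E) :=
    inferInstanceAs <| T2Space ((w : InfinitePlace E) → w.Completion)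
  exact inferInstanceAs <| T2Space (InfiniteAdeleRing E × FiniteAdeleRing (𝓞 E) E)

/-- `N(𝔸_F)` is a second countable locally compact group and `N(F)` is countable (private plumbing,
local copy). [folklore] -/
private theorem topology_adelicUnipotent' :
    LocallyCompactSpace (adelicUnipotent F E c N) ∧ SecondCountableTopology (adelicUnipotent F E c N) ∧
      Countable (rationalUnipotent F E c N) ∧ T2Space (adelicUnipotent F E c N) := by
  haveI := secondCountableTopology_adeleRing E
  haveI := locallyCompactSpace_adeleRing' E
  haveI := t2Space_adeleRing_E''' (E := E)
  haveI : LocallyCompactSpace (quasiSplit F E c N).Adelic :=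
    inferInstanceAs (LocallyCompactSpace (adelic F E c N ((StdForm.antidiagonal N).over E)))
  haveI : SecondCountableTopology (quasiSplit F E c N).Adelic :=
    inferInstanceAs (SecondCountableTopology (adelic F E c N ((StdForm.antidiagonal N).over E)))
  haveI : T2Space (quasiSplit F E c N).Adelic :=
    inferInstanceAs (T2Space (adelic F E c N ((StdForm.antidiagonal N).over E)))
  have hcl : IsClosed ((adelicUnipotent F E c N : Set (quasiSplit F E c N).Adelic)) := by
    change IsClosed (⇑(adelicVal F E c N ((StdForm.antidiagonal N).over E)) ⁻¹'
      ((upperUnitriangular (Fin N) (AdeleRing (𝓞 E) E) : Subgroup (GL (Fin N) (AdeleRing (𝓞 E) E))) :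
        Set (GL (Fin N) (AdeleRing (𝓞 E) E))))
    exact (isClosed_upperUnitriangular (R := AdeleRing (𝓞 E) E)).preimage continuous_subtype_val
  refine ⟨hcl.locallyCompactSpace, TopologicalSpace.Subtype.secondCountableTopology _, ?_, inferInstance⟩
  have hinj : Function.Injective fun γ : rationalUnipotent F E c N =>
      (⟨((γ : adelicUnipotent F E c N) : (quasiSplit F E c N).Adelic), γ.2⟩ :
        (quasiSplit F E c N).arithmeticSubgroup) := by
    intro a a' h
    exact Subtype.ext (Subtype.ext (congrArg
      (fun z : (quasiSplit F E c N).arithmeticSubgroup => (z : (quasiSplit F E c N).Adelic)) h))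
  haveI : Countable (quasiSplit F E c N).arithmeticSubgroup := by
    haveI : Countable E := NumberField.countable' (K := E)
    haveI : Countable (Matrix (Fin N) (Fin N) E) := inferInstanceAs (Countable (Fin N → Fin N → E))
    haveI : Countable (GL (Fin N) E) := Units.val_injective.countable
    haveI : Countable (quasiSplit F E c N).Rational :=
      inferInstanceAs (Countable (rational F E c N ((StdForm.antidiagonal N).over E)))
    exact (Set.countable_range _).to_subtype
  exact hinj.countable

/-! ## §2 `φ_B(n g) = φ_B(g)` for `n ∈ N(𝔸_F)`, given a right-invariant Haar measure -/

section UnipotentInvariance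

variable [MeasurableSpace (adelicUnipotent F E c N)] [BorelSpace (adelicUnipotent F E c N)]

/-- **The Borel constant term is left `N(𝔸_F)`-invariant** when the Haar measure `ν` of `N(𝔸_F)` is
also right invariant (always the case: `N(𝔸_F)` carries the lattice `N(F)`; proved below for
`U(3)`): `φ_B(n g) = φ_B(g)` for `n ∈ N(𝔸_F)` and left `N(F)`-invariant `φ`, every fundamental domain
`𝓕` (Rogawski (1990), §2.1: `φ_P` is a function on `N(𝔸)P(F)\G(𝔸)`; Mœglin–Waldspurger (1995),
I.2.6). [cite: Rogawski1990, §2.1 (p. 11)] -/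
theorem borelConstantTerm_unipotent_mul_of_isMulRightInvariant (ν : Measure (adelicUnipotent F E c N))
    [ν.IsHaarMeasure] [ν.IsMulRightInvariant] {𝓕 : Set (adelicUnipotent F E c N)}
    (h𝓕 : IsFundamentalDomain (rationalUnipotent F E c N) 𝓕 ν)
    {φ : (quasiSplit F E c N).Adelic → ℂ}
    (hφ : ∀ u : adelicUnipotent F E c N, u ∈ rationalUnipotent F E c N →
      ∀ x : (quasiSplit F E c N).Adelic, φ ((u : (quasiSplit F E c N).Adelic) * x) = φ x)
    (n : adelicUnipotent F E c N) (g : (quasiSplit F E c N).Adelic) :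
    borelConstantTerm ν 𝓕 φ ((n : (quasiSplit F E c N).Adelic) * g) = borelConstantTerm ν 𝓕 φ g := by
  obtain ⟨_, _, _, _⟩ := topology_adelicUnipotent' (F := F) (E := E) (c := c) (N := N)
  have hφ' : ∀ γ ∈ rationalUnipotent F E c N, ∀ u : adelicUnipotent F E c N,
      φ (((γ * u : adelicUnipotent F E c N) : (quasiSplit F E c N).Adelic) * g) =
        φ ((u : (quasiSplit F E c N).Adelic) * g) := by
    intro γ hγ u
    rw [Subgroup.coe_mul, mul_assoc]
    exact hφ γ hγ _
  have h := setIntegral_mul_right_eq_of_isFundamentalDomain (rationalUnipotent F E c N) ν h𝓕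
    (f := fun u : adelicUnipotent F E c N => φ ((u : (quasiSplit F E c N).Adelic) * g)) hφ' n
  rw [borelConstantTerm_def, borelConstantTerm_def]
  congr 1
  simpa only [Subgroup.coe_mul, mul_assoc] using h

end UnipotentInvariance

/-! ## §3 `U(3)`: every fundamental domain of `N(F)` has finite positive measure; `N(𝔸_F)` is
unimodular; `φ_B` is left `N(𝔸_F)`-invariant -/

section Three

variable [MeasurableSpace (adelicUnipotent F E c N)] [BorelSpace (adelicUnipotent F E c N)]

/-- **Fundamental domains of `N(F)` have non-zero measure** for every Haar measure `ν` of `N(𝔸_F)`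
(every `N`): the countably many translates `γ 𝓕`, `γ ∈ N(F)`, cover `N(𝔸_F)`
(Mathlib `IsFundamentalDomain.measure_ne_zero`). [cite: Rogawski1990, §1.10] -/
theorem measure_ne_zero_of_isFundamentalDomain_rationalUnipotent (ν : Measure (adelicUnipotent F E c N))
    [ν.IsHaarMeasure] {𝓕 : Set (adelicUnipotent F E c N)}
    (h𝓕 : IsFundamentalDomain (rationalUnipotent F E c N) 𝓕 ν) : ν 𝓕 ≠ 0 := by
  obtain ⟨_, _, _, _⟩ := topology_adelicUnipotent' (F := F) (E := E) (c := c) (N := N)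
  haveI : MeasurableConstSMul (rationalUnipotent F E c N) (adelicUnipotent F E c N) :=
    ⟨fun γ => (continuous_const.mul continuous_id).measurable⟩
  haveI : SMulInvariantMeasure (rationalUnipotent F E c N) (adelicUnipotent F E c N) ν :=
    ⟨fun γ s _hs => by
      rw [show (fun x : adelicUnipotent F E c N => γ • x) ⁻¹' s =
          (fun x : adelicUnipotent F E c N => (γ : adelicUnipotent F E c N) * x) ⁻¹' s from rfl,
        measure_preimage_mul]⟩
  refine h𝓕.measure_ne_zero (fun hν => ?_)
  have h := isOpen_univ.measure_ne_zero ν univ_nonempty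
  rw [hν] at h
  exact h rfl

end Three

section ThreeOnly

variable [MeasurableSpace (adelicUnipotent F E c 3)] [BorelSpace (adelicUnipotent F E c 3)]

/-- **Fundamental domains of `N(F)` in the Heisenberg group `N(𝔸_F)` of `U(3)` have finite measure**
for every Haar measure: all fundamental domains have the measure of the relatively compact one
★ `heisFundamentalDomain` (Rogawski (1990), §1.10: `N(F)\𝐍` is compact). [cite: Rogawski1990, §1.10] -/
theorem measure_lt_top_of_isFundamentalDomain_rationalUnipotent_three (hc : c * c = 1)
    (ν : Measure (adelicUnipotent F E c 3)) [ν.IsHaarMeasure] {𝓕 : Set (adelicUnipotent F E c 3)}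
    (h𝓕 : IsFundamentalDomain (rationalUnipotent F E c 3) 𝓕 ν) : ν 𝓕 < ∞ := by
  obtain ⟨_, _, _, _⟩ := topology_adelicUnipotent' (F := F) (E := E) (c := c) (N := 3)
  haveI : MeasurableConstSMul (rationalUnipotent F E c 3) (adelicUnipotent F E c 3) :=
    ⟨fun γ => (continuous_const.mul continuous_id).measurable⟩
  haveI : SMulInvariantMeasure (rationalUnipotent F E c 3) (adelicUnipotent F E c 3) ν :=
    ⟨fun γ s _hs => by
      rw [show (fun x : adelicUnipotent F E c 3 => γ • x) ⁻¹' s =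
          (fun x : adelicUnipotent F E c 3 => (γ : adelicUnipotent F E c 3) * x) ⁻¹' s from rfl,
        measure_preimage_mul]⟩
  letI : MeasurableSpace (AdeleRing (𝓞 E) E) := borel _
  haveI : BorelSpace (AdeleRing (𝓞 E) E) := ⟨rfl⟩
  have h0 := isFundamentalDomain_heisFundamentalDomain (F := F) (E := E) (c := c) hc ν
  obtain ⟨C, hC, hsub⟩ := exists_isCompact_heisFundamentalDomain_subset (F := F) (E := E) (c := c) hc
  rw [h𝓕.measure_eq h0]
  exact (measure_mono hsub).trans_lt hC.measure_lt_top

/-- Hence the normalising factor of the T1-qs letters is honest on `U(3)`: `0 < (ν 𝓕).toReal` for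
every Haar measure and every fundamental domain. [cite: Rogawski1990, §1.10] -/
theorem toReal_measure_pos_of_isFundamentalDomain_rationalUnipotent_three (hc : c * c = 1)
    (ν : Measure (adelicUnipotent F E c 3)) [ν.IsHaarMeasure] {𝓕 : Set (adelicUnipotent F E c 3)}
    (h𝓕 : IsFundamentalDomain (rationalUnipotent F E c 3) 𝓕 ν) : 0 < (ν 𝓕).toReal :=
  ENNReal.toReal_pos (measure_ne_zero_of_isFundamentalDomain_rationalUnipotent ν h𝓕)
    (measure_lt_top_of_isFundamentalDomain_rationalUnipotent_three hc ν h𝓕).ne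

/-- **`N(𝔸_F)` of `U(3)` is unimodular**: every Haar measure on the adelic Heisenberg group is right
invariant — the lattice `N(F)` has fundamental domains of finite positive measure, so the modular
function is trivial (★ `isMulRightInvariant_of_isFundamentalDomain`; Deitmar–Echterhoff (2014),
Thm. 9.1.6: a group admitting a lattice is unimodular). [cite: DeitmarEchterhoff2014, Thm. 9.1.6] -/
theorem isMulRightInvariant_of_isHaarMeasure_adelicUnipotent_three (hc : c * c = 1)
    (ν : Measure (adelicUnipotent F E c 3)) [ν.IsHaarMeasure] : ν.IsMulRightInvariant := by
  obtain ⟨_, _, _, _⟩ := topology_adelicUnipotent' (F := F) (E := E) (c := c) (N := 3)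
  haveI : ν.InnerRegular := inferInstance
  letI : MeasurableSpace (AdeleRing (𝓞 E) E) := borel _
  haveI : BorelSpace (AdeleRing (𝓞 E) E) := ⟨rfl⟩
  have h0 := isFundamentalDomain_heisFundamentalDomain (F := F) (E := E) (c := c) hc ν
  exact isMulRightInvariant_of_isFundamentalDomain (rationalUnipotent F E c 3) ν h0
    (measure_ne_zero_of_isFundamentalDomain_rationalUnipotent ν h0)
    (measure_lt_top_of_isFundamentalDomain_rationalUnipotent_three hc ν h0).ne

/-- **On `U(3)` the Borel constant term of a left `N(F)`-invariant function is left
`N(𝔸_F)`-invariant**, for every Haar measure and every fundamental domain: `φ_B(n g) = φ_B(g)`,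
`n ∈ N(𝔸_F)` (Rogawski (1990), §2.1). [cite: Rogawski1990, §2.1 (p. 11)] -/
theorem borelConstantTerm_unipotent_mul_three (hc : c * c = 1) (ν : Measure (adelicUnipotent F E c 3))
    [ν.IsHaarMeasure] {𝓕 : Set (adelicUnipotent F E c 3)}
    (h𝓕 : IsFundamentalDomain (rationalUnipotent F E c 3) 𝓕 ν)
    {φ : (quasiSplit F E c 3).Adelic → ℂ}
    (hφ : ∀ u : adelicUnipotent F E c 3, u ∈ rationalUnipotent F E c 3 →
      ∀ x : (quasiSplit F E c 3).Adelic, φ ((u : (quasiSplit F E c 3).Adelic) * x) = φ x)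
    (n : adelicUnipotent F E c 3) (g : (quasiSplit F E c 3).Adelic) :
    borelConstantTerm ν 𝓕 φ ((n : (quasiSplit F E c 3).Adelic) * g) = borelConstantTerm ν 𝓕 φ g := by
  haveI := isMulRightInvariant_of_isHaarMeasure_adelicUnipotent_three hc ν
  exact borelConstantTerm_unipotent_mul_of_isMulRightInvariant ν h𝓕 hφ n g

/-- **On `U(3)`, `φ_B(g) = 0 ↔ ∫_𝓕 φ(u g) dν(u) = 0`** — the normalising factor `ν(𝓕)⁻¹` is never
the junk value, so the Borel cusp condition of the letters is the vanishing of honest integrals.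
[cite: Rogawski1990, §2.1 (p. 11)] -/
theorem borelConstantTerm_eq_zero_iff_three (hc : c * c = 1) (ν : Measure (adelicUnipotent F E c 3))
    [ν.IsHaarMeasure] {𝓕 : Set (adelicUnipotent F E c 3)}
    (h𝓕 : IsFundamentalDomain (rationalUnipotent F E c 3) 𝓕 ν)
    (φ : (quasiSplit F E c 3).Adelic → ℂ) (g : (quasiSplit F E c 3).Adelic) :
    borelConstantTerm ν 𝓕 φ g = 0 ↔
      ∫ u in 𝓕, φ ((u : (quasiSplit F E c 3).Adelic) * g) ∂ν = 0 := by
  rw [borelConstantTerm_def, smul_eq_zero]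
  have h := toReal_measure_pos_of_isFundamentalDomain_rationalUnipotent_three hc ν h𝓕
  exact ⟨fun h' => h'.resolve_left (inv_ne_zero h.ne'), fun h' => Or.inr h'⟩

/-- **On `U(3)`, the data-free Borel cusp condition is Borel-cuspidality for any ONE Haar measure and
ONE fundamental domain**, for continuous left `N(F)`-invariant `φ`:
`BorelCuspCondition φ ↔ IsBorelCuspidal ν₀ 𝓕₀ φ`. (`→`) is ★ `BorelCuspCondition.isBorelCuspidal`;
(`←`): for any other Borel data `(ν, 𝓕)`, `φ_B^{ν,𝓕} = φ_B^{ν₀,𝓕₀} = 0`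
(★ `borelConstantTerm_eq_of_isHaarMeasure`), the normaliser is honest
(`borelConstantTerm_eq_zero_iff_three`), and `u ↦ φ(u g)` is integrable on every fundamental domain,
being so on the relatively compact ★ `heisFundamentalDomain` (Mathlib
`IsFundamentalDomain.integrableOn_iff`). So the accepted `BorelCuspCondition` ∕ `IsBorelCuspForm`
(`UnitaryGroupBorelTruncation`, `UnitaryGroupBorelCuspForms`) and the fixed-data `IsBorelCuspidal` agree
on continuous automorphic functions of `U(3)` (Rogawski (1990), §2.1: cusp forms, `φ_P = 0`).
[cite: Rogawski1990, §2.1 (pp. 11–12)] -/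
theorem borelCuspCondition_iff_isBorelCuspidal_three (hc : c * c = 1)
    {φ : (quasiSplit F E c 3).Adelic → ℂ} (hφc : Continuous φ)
    (hφ : ∀ u : adelicUnipotent F E c 3, u ∈ rationalUnipotent F E c 3 →
      ∀ x : (quasiSplit F E c 3).Adelic, φ ((u : (quasiSplit F E c 3).Adelic) * x) = φ x)
    (ν₀ : Measure (adelicUnipotent F E c 3)) [ν₀.IsHaarMeasure] {𝓕₀ : Set (adelicUnipotent F E c 3)}
    (h𝓕₀ : IsFundamentalDomain (rationalUnipotent F E c 3) 𝓕₀ ν₀) :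
    BorelCuspCondition F E c 3 φ ↔ IsBorelCuspidal ν₀ 𝓕₀ φ := by
  refine ⟨fun h => h.isBorelCuspidal ν₀ h𝓕₀, fun h => ?_⟩
  -- the given σ-algebra is the Borel one; so is the one quantified in `BorelCuspCondition`
  have hB0 := ‹BorelSpace (adelicUnipotent F E c 3)›.measurable_eq
  intro mN bN ν hν 𝓕 h𝓕 g
  have hm : mN = _ := bN.measurable_eq.trans hB0.symm
  subst hm
  obtain ⟨_, _, _, _⟩ := topology_adelicUnipotent' (F := F) (E := E) (c := c) (N := 3)
  haveI : MeasurableConstSMul (rationalUnipotent F E c 3) (adelicUnipotent F E c 3) :=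
    ⟨fun γ => (continuous_const.mul continuous_id).measurable⟩
  haveI : SMulInvariantMeasure (rationalUnipotent F E c 3) (adelicUnipotent F E c 3) ν :=
    ⟨fun γ s _hs => by
      rw [show (fun x : adelicUnipotent F E c 3 => γ • x) ⁻¹' s =
          (fun x : adelicUnipotent F E c 3 => (γ : adelicUnipotent F E c 3) * x) ⁻¹' s from rfl,
        measure_preimage_mul]⟩
  -- integrability on every fundamental domain, from the relatively compact one
  letI : MeasurableSpace (AdeleRing (𝓞 E) E) := borel _
  haveI : BorelSpace (AdeleRing (𝓞 E) E) := ⟨rfl⟩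
  set f : adelicUnipotent F E c 3 → ℂ := fun u => φ ((u : (quasiSplit F E c 3).Adelic) * g) with hf
  have hf_inv : ∀ (γ : rationalUnipotent F E c 3) (u : adelicUnipotent F E c 3), f (γ • u) = f u := by
    intro γ u
    simp only [hf, Subgroup.smul_def, smul_eq_mul, Subgroup.coe_mul, mul_assoc]
    exact hφ _ γ.2 _
  have hfc : Continuous f := hφc.comp (continuous_subtype_val.mul continuous_const)
  have h0 := isFundamentalDomain_heisFundamentalDomain (F := F) (E := E) (c := c) hc ν
  obtain ⟨C, hC, hsub⟩ := exists_isCompact_heisFundamentalDomain_subset (F := F) (E := E) (c := c) hc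
  have hint0 : IntegrableOn f (heisFundamentalDomain F E c hc) ν :=
    (hfc.continuousOn.integrableOn_compact hC).mono_set hsub
  refine ⟨(h0.integrableOn_iff h𝓕 hf_inv).1 hint0, ?_⟩
  -- vanishing: `φ_B^{ν,𝓕} = φ_B^{ν₀,𝓕₀} = 0`, and the normaliser is honest
  have hB : borelConstantTerm ν 𝓕 φ g = 0 := by
    rw [borelConstantTerm_eq_of_isHaarMeasure ν ν₀ h𝓕 h𝓕₀ hφ]
    exact h g
  exact (borelConstantTerm_eq_zero_iff_three hc ν h𝓕 φ g).1 hB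

end ThreeOnly

end UnitaryGroup

end Literature.NumberTheory.Automorphic
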